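import Summits.Ventures.LatticeQCDFlow.Scaling.HomStarCollectorFloor

/-!
HONEST FRAMING: exact (Metropolis-corrected) sampling algorithms for lattice gauge theory; figures
of merit are autocorrelation/cost numbers at stated couplings and volumes; no continuum-physics
claim.

# HomStarFullCollectorFloor — THE `log K` FLOOR WITH ITS PERSISTENCE FACTOR FOR THE FULL CONFIGURATION LAW OF CHAPTER U's HOMOGENEOUS REPLICA-EXCHANGE STAR: A LUMPING NEVER INCREASES
# TOTAL VARIATION, SO FROM `y_u ≡ u` THE SCHEME's OWN LAW IS AT DISTANCE `≥ 1 − s/(s−m)² − (μ_0(u)+Kμ_1(u))/m` FROM `μ_0⊗μ_1⊗⋯⊗μ_1`, `s = K(1−ta/K)ⁿ`, AND `≥ 1/3` FOR EVERY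
# `n ≤ (K/(ta) − 1)·log(K/(3(μ_0(u)+Kμ_1(u)+2)))` — HEAVY REPLICAS ARE HARD TO DISLODGE (`a = W₂/W_u`) (lean-2 GEN-45, ours)

Venture-side (OURS).  Cell `lqcd-flow` (pub-lqcd), unit `pub-lqcd-lean-2-g45`, 2026-08-31.  Chapter AE, file 15 — file 3 carried back from the pooled law to the configuration law.
`tvDist_pushforward_le`: for every map `Λ` and all laws `ν, π`, `‖Λ_*ν − Λ_*π‖_TV ≤ ‖ν − π‖_TV` (the triangle inequality fibre by fibre); with AD15's `π_S = Λ_*(μ_0⊗μ_1⊗⋯⊗μ_1)` file 3's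
floor for the pooled law is a floor for the scheme's configuration law against its own product equilibrium.

* `tvDist_pushforward_le`, **`homStar_full_tvDist_ge_collector_law`**, **`homStar_full_tvDist_ge_third`**, **`homStar_full_lt_mixingTime`** (with `d(t₀) ≤ ¼` at some time as a hypothesis).

Reading (no numerics implied): chapter L's hub floor (L5: `(K/θ_Σ − 1)·log(Kη)` from a start rare for the cold laws) counts proposals, so it cannot see the acceptance step; here the
rate is `ta/K` with `acc(·,u) ≤ a` off `u` — for the most persistent content `u`, `a = W₂/W_u`: the configuration law of the actual scheme needs `≥ (K·W_u/(t·W₂))·log(K/(3(μ_0(u) +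
Kμ_1(u) + 2)))` steps, the persistence ratio multiplying the coupon-collector time (law-dependent through `E N(u)` as in file 3).  Literature grade (cell rule): OWN, elementary on file 3
and AD15; nothing cited as a fact; no new bib keys.
-/

noncomputable section

open Finset Function
open Literature.Probability.MarkovChains

namespace Summit.Ventures.LatticeQCDFlow.Scaling

/-! ## §1 A lumping never increases total variation -/

section Pushforward
variable {Y X : Type*} [Fintype Y] [Fintype X] [DecidableEq X]

/-- **`‖Λ_*ν − Λ_*π‖_TV ≤ ‖ν − π‖_TV`** for every map `Λ : Y → X` and all `ν, π : Y → ℝ`. [ours] -/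
theorem tvDist_pushforward_le (Λ : Y → X) (ν π : Y → ℝ) :
    tvDist (fun x => ∑ y ∈ univ.filter (fun y => Λ y = x), ν y) (fun x => ∑ y ∈ univ.filter (fun y => Λ y = x), π y) ≤ tvDist ν π := by
  unfold tvDist
  refine mul_le_mul_of_nonneg_left ?_ (by norm_num)
  calc ∑ x, |∑ y ∈ univ.filter (fun y => Λ y = x), ν y - ∑ y ∈ univ.filter (fun y => Λ y = x), π y|
      = ∑ x, |∑ y ∈ univ.filter (fun y => Λ y = x), (ν y - π y)| := sum_congr rfl fun x _ => by rw [sum_sub_distrib]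
    _ ≤ ∑ x, ∑ y ∈ univ.filter (fun y => Λ y = x), |ν y - π y| := sum_le_sum fun x _ => Finset.abs_sum_le_sum_abs _ _
    _ = ∑ y, |ν y - π y| := Finset.sum_fiberwise_of_maps_to (fun y _ => mem_univ (Λ y)) _

end Pushforward

/-! ## §2 The configuration law of the homogeneous star -/

section FullLaw
variable {S : Type*} [Fintype S] [DecidableEq S] {K m : ℕ} {μ : Fin (K + 1) → S → ℝ} {M : Fin (K + 1) → S → S → ℝ} {w : Fin (K + 1) → ℝ} {t : ℝ}
variable (κ : Fin m → Fin K)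
variable {X : Type*} [Fintype X] [DecidableEq X] {hub : X → S} {comp : X → S → ℕ} {W : S → ℝ} {acc : S → S → ℝ} {Kh : (S → ℕ) → S → S → ℝ}
variable {Ast Bst Sl : X → X → ℝ} {g : (S → ℕ) → ℝ} {πS : X → ℝ} {Z : ℝ}
variable {Λ : (Fin (K + 1) → S) → X}

/-- **THE COLLECTOR FLOOR FOR THE CONFIGURATION LAW:** from `y_u ≡ u`, for `0 < m < s = K(1−ta/K)ⁿ` (`acc(·,u) ≤ a ∈ [0,1]` off `u`, `K ≥ 2`),
**`‖δ_{y_u}Pⁿ − μ_0⊗μ_1⊗⋯⊗μ_1‖_TV ≥ 1 − s/(s−m)² − (μ_0(u) + Kμ_1(u))/m`**. [ours] -/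
theorem homStar_full_tvDist_ge_collector_law [Nonempty X] (hm : 1 ≤ m) (hμ : ∀ k x, 0 < μ k x) (hμsum : ∀ k, ∑ u, μ k u = 1)
    (hhom : ∀ i : Fin K, μ i.succ = μ 1) (hw0 : ∀ k, 0 ≤ w k) (hw00 : 0 < w 0) (hw1 : ∑ k, w k = 1) (ht0 : 0 < t) (ht1 : t < 1)
    (hM0 : ∀ u v, M 0 u v = μ 0 v) (hidle : ∀ i : Fin K, ∀ u v, M i.succ u v = if v = u then 1 else 0)
    {c : ℕ} (hunif : ∀ i : Fin K, (univ.filter fun r : Fin m => κ r = i).card = c)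
    (hWdef : ∀ v, W v = μ 1 v / μ 0 v) (hinj : ∀ x x', hub x = hub x' → comp x = comp x' → x = x') (hsum : ∀ x, ∑ v, comp x v = K + 1)
    (hsurj : ∀ (z : S) (N : S → ℕ), ∑ v, N v = K + 1 → N z ≠ 0 → ∃ x, hub x = z ∧ comp x = N) (hhub : ∀ x, comp x (hub x) ≠ 0) (hK : 2 ≤ K)
    (hacc : ∀ h v, acc h v = min 1 (W h / W v))
    (hKoff : ∀ N h v, h ≠ v → Kh N h v = if N h = 0 then 0 else (N v : ℝ) / K * acc h v) (hKdiag : ∀ N h, Kh N h h = 1 - ∑ v ∈ univ.erase h, Kh N h v)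
    (hA : ∀ x x', Ast x x' = if comp x' = comp x then Kh (comp x) (hub x) (hub x') else 0)
    (hB : ∀ x x', Bst x x' = μ 0 (hub x') * (if comp x' + Pi.single (hub x) 1 = comp x + Pi.single (hub x') 1 then 1 else 0))
    (hSl : ∀ x x', Sl x x' = t * Ast x x' + (1 - t) * (w 0 * Bst x x' + (1 - w 0) * (if x = x' then 1 else 0)))
    (hg : ∀ N, g N = ∏ v, (μ 0 v * W v) ^ (N v) / ((N v).factorial : ℝ))
    (hZ : Z = ∑ x, g (comp x) * ((comp x (hub x) : ℝ) / W (hub x))) (hπS : ∀ x, πS x = g (comp x) * ((comp x (hub x) : ℝ) / W (hub x)) / Z)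
    (hΛh : ∀ y, hub (Λ y) = y 0) (hΛc : ∀ y v, comp (Λ y) v = (univ.filter fun k : Fin (K + 1) => y k = v).card)
    (u : S) {a : ℝ} (ha0 : 0 ≤ a) (ha1 : a ≤ 1) (ha : ∀ h, h ≠ u → acc h u ≤ a) (n : ℕ) {mm : ℝ} (hmm : 0 < mm)
    (hms : mm < (K : ℝ) * (1 - t * a / K) ^ n) :
    1 - (K : ℝ) * (1 - t * a / K) ^ n / ((K : ℝ) * (1 - t * a / K) ^ n - mm) ^ 2 - (μ 0 u + K * μ 1 u) / mm
      ≤ tvDist (lawAt (fun y z => t * ptGraphSwap μ (fun r : Fin m => (((0 : Fin (K + 1)), (κ r).succ) : Fin (K + 1) × Fin (K + 1))) (fun _ : Fin m => Equiv.refl S) y z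
            + (1 - t) * prodKernel w M y z) (Pi.single (fun _ : Fin (K + 1) => u) 1) n) (tensorFun μ) := by
  classical
  have hpool := homStar_pooled_tvDist_ge_collector_law κ hm hμ hμsum hhom hw0 hw00 hw1 ht0 ht1 hM0 hidle hunif hWdef hinj hsum hsurj hhub hK hacc hKoff hKdiag hA hB hSl hg
    hZ hπS hΛh hΛc u ha0 ha1 ha n hmm hms
  have hπ : πS = fun x => ∑ y ∈ univ.filter (fun y => Λ y = x), tensorFun μ y := funext fun x =>
    homStar_piS_eq_pushforward κ hm hμ hμsum hhom hw0 hw00 hw1 ht0 ht1 hM0 hidle hunif hWdef hinj hsum hsurj hhub (by omega) hacc hKoff hKdiag hA hB hSl hg hZ hπS hΛh hΛc x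
  rw [hπ] at hpool
  exact hpool.trans (tvDist_pushforward_le Λ _ _)

/-- **THE `log K` FLOOR FOR THE CONFIGURATION LAW:** for every `n ≤ (K/(ta) − 1)·log(K/(3(μ_0(u) + Kμ_1(u) + 2)))` (`0 < a ≤ 1` with `acc(·,u) ≤ a` off `u`; `a = W₂/W_u` for the most
persistent `u`), **`‖δ_{y_u}Pⁿ − μ_0⊗μ_1⊗⋯⊗μ_1‖_TV ≥ 1/3`**. [ours] -/
theorem homStar_full_tvDist_ge_third [Nonempty X] (hm : 1 ≤ m) (hμ : ∀ k x, 0 < μ k x) (hμsum : ∀ k, ∑ u, μ k u = 1)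
    (hhom : ∀ i : Fin K, μ i.succ = μ 1) (hw0 : ∀ k, 0 ≤ w k) (hw00 : 0 < w 0) (hw1 : ∑ k, w k = 1) (ht0 : 0 < t) (ht1 : t < 1)
    (hM0 : ∀ u v, M 0 u v = μ 0 v) (hidle : ∀ i : Fin K, ∀ u v, M i.succ u v = if v = u then 1 else 0)
    {c : ℕ} (hunif : ∀ i : Fin K, (univ.filter fun r : Fin m => κ r = i).card = c)
    (hWdef : ∀ v, W v = μ 1 v / μ 0 v) (hinj : ∀ x x', hub x = hub x' → comp x = comp x' → x = x') (hsum : ∀ x, ∑ v, comp x v = K + 1)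
    (hsurj : ∀ (z : S) (N : S → ℕ), ∑ v, N v = K + 1 → N z ≠ 0 → ∃ x, hub x = z ∧ comp x = N) (hhub : ∀ x, comp x (hub x) ≠ 0) (hK : 2 ≤ K)
    (hacc : ∀ h v, acc h v = min 1 (W h / W v))
    (hKoff : ∀ N h v, h ≠ v → Kh N h v = if N h = 0 then 0 else (N v : ℝ) / K * acc h v) (hKdiag : ∀ N h, Kh N h h = 1 - ∑ v ∈ univ.erase h, Kh N h v)
    (hA : ∀ x x', Ast x x' = if comp x' = comp x then Kh (comp x) (hub x) (hub x') else 0)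
    (hB : ∀ x x', Bst x x' = μ 0 (hub x') * (if comp x' + Pi.single (hub x) 1 = comp x + Pi.single (hub x') 1 then 1 else 0))
    (hSl : ∀ x x', Sl x x' = t * Ast x x' + (1 - t) * (w 0 * Bst x x' + (1 - w 0) * (if x = x' then 1 else 0)))
    (hg : ∀ N, g N = ∏ v, (μ 0 v * W v) ^ (N v) / ((N v).factorial : ℝ))
    (hZ : Z = ∑ x, g (comp x) * ((comp x (hub x) : ℝ) / W (hub x))) (hπS : ∀ x, πS x = g (comp x) * ((comp x (hub x) : ℝ) / W (hub x)) / Z)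
    (hΛh : ∀ y, hub (Λ y) = y 0) (hΛc : ∀ y v, comp (Λ y) v = (univ.filter fun k : Fin (K + 1) => y k = v).card)
    (u : S) {a : ℝ} (ha0 : 0 < a) (ha1 : a ≤ 1) (ha : ∀ h, h ≠ u → acc h u ≤ a) {n : ℕ}
    (hn : (n : ℝ) ≤ ((K : ℝ) / (t * a) - 1) * Real.log ((K : ℝ) / (3 * (μ 0 u + K * μ 1 u + 2)))) :
    1 / 3 ≤ tvDist (lawAt (fun y z => t * ptGraphSwap μ (fun r : Fin m => (((0 : Fin (K + 1)), (κ r).succ) : Fin (K + 1) × Fin (K + 1))) (fun _ : Fin m => Equiv.refl S) y z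
            + (1 - t) * prodKernel w M y z) (Pi.single (fun _ : Fin (K + 1) => u) 1) n) (tensorFun μ) := by
  classical
  have hpool := homStar_pooled_tvDist_ge_third κ hm hμ hμsum hhom hw0 hw00 hw1 ht0 ht1 hM0 hidle hunif hWdef hinj hsum hsurj hhub hK hacc hKoff hKdiag hA hB hSl hg hZ hπS hΛh
    hΛc u ha0 ha1 ha hn
  have hπ : πS = fun x => ∑ y ∈ univ.filter (fun y => Λ y = x), tensorFun μ y := funext fun x =>
    homStar_piS_eq_pushforward κ hm hμ hμsum hhom hw0 hw00 hw1 ht0 ht1 hM0 hidle hunif hWdef hinj hsum hsurj hhub (by omega) hacc hKoff hKdiag hA hB hSl hg hZ hπS hΛh hΛc x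
  rw [hπ] at hpool
  exact hpool.trans (tvDist_pushforward_le Λ _ _)

/-- **BEFORE THE COUPON-COLLECTOR TIME THE SCHEME IS NOT MIXED:** if the scheme is `¼`-close to `μ_0⊗μ_1⊗⋯⊗μ_1` at some time (it is reversible with respect to it, AD15), then every
`n ≤ (K/(ta) − 1)·log(K/(3(μ_0(u)+Kμ_1(u)+2)))` has **`n < t_mix(1/4)`**. [ours] -/
theorem homStar_full_lt_mixingTime [Nonempty X] (hm : 1 ≤ m) (hμ : ∀ k x, 0 < μ k x) (hμsum : ∀ k, ∑ u, μ k u = 1)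
    (hhom : ∀ i : Fin K, μ i.succ = μ 1) (hw0 : ∀ k, 0 ≤ w k) (hw00 : 0 < w 0) (hw1 : ∑ k, w k = 1) (ht0 : 0 < t) (ht1 : t < 1)
    (hM0 : ∀ u v, M 0 u v = μ 0 v) (hidle : ∀ i : Fin K, ∀ u v, M i.succ u v = if v = u then 1 else 0)
    {c : ℕ} (hunif : ∀ i : Fin K, (univ.filter fun r : Fin m => κ r = i).card = c)
    (hWdef : ∀ v, W v = μ 1 v / μ 0 v) (hinj : ∀ x x', hub x = hub x' → comp x = comp x' → x = x') (hsum : ∀ x, ∑ v, comp x v = K + 1)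
    (hsurj : ∀ (z : S) (N : S → ℕ), ∑ v, N v = K + 1 → N z ≠ 0 → ∃ x, hub x = z ∧ comp x = N) (hhub : ∀ x, comp x (hub x) ≠ 0) (hK : 2 ≤ K)
    (hacc : ∀ h v, acc h v = min 1 (W h / W v))
    (hKoff : ∀ N h v, h ≠ v → Kh N h v = if N h = 0 then 0 else (N v : ℝ) / K * acc h v) (hKdiag : ∀ N h, Kh N h h = 1 - ∑ v ∈ univ.erase h, Kh N h v)
    (hA : ∀ x x', Ast x x' = if comp x' = comp x then Kh (comp x) (hub x) (hub x') else 0)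
    (hB : ∀ x x', Bst x x' = μ 0 (hub x') * (if comp x' + Pi.single (hub x) 1 = comp x + Pi.single (hub x') 1 then 1 else 0))
    (hSl : ∀ x x', Sl x x' = t * Ast x x' + (1 - t) * (w 0 * Bst x x' + (1 - w 0) * (if x = x' then 1 else 0)))
    (hg : ∀ N, g N = ∏ v, (μ 0 v * W v) ^ (N v) / ((N v).factorial : ℝ))
    (hZ : Z = ∑ x, g (comp x) * ((comp x (hub x) : ℝ) / W (hub x))) (hπS : ∀ x, πS x = g (comp x) * ((comp x (hub x) : ℝ) / W (hub x)) / Z)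
    (hΛh : ∀ y, hub (Λ y) = y 0) (hΛc : ∀ y v, comp (Λ y) v = (univ.filter fun k : Fin (K + 1) => y k = v).card)
    (u : S) {a : ℝ} (ha0 : 0 < a) (ha1 : a ≤ 1) (ha : ∀ h, h ≠ u → acc h u ≤ a)
    (hmix : ∃ t₀, worstTvDist (fun y z => t * ptGraphSwap μ (fun r : Fin m => (((0 : Fin (K + 1)), (κ r).succ) : Fin (K + 1) × Fin (K + 1))) (fun _ : Fin m => Equiv.refl S) y z
            + (1 - t) * prodKernel w M y z) (tensorFun μ) t₀ ≤ 1 / 4) {n : ℕ}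
    (hn : (n : ℝ) ≤ ((K : ℝ) / (t * a) - 1) * Real.log ((K : ℝ) / (3 * (μ 0 u + K * μ 1 u + 2)))) :
    n < mixingTime (fun y z => t * ptGraphSwap μ (fun r : Fin m => (((0 : Fin (K + 1)), (κ r).succ) : Fin (K + 1) × Fin (K + 1))) (fun _ : Fin m => Equiv.refl S) y z
            + (1 - t) * prodKernel w M y z) (tensorFun μ) (1 / 4) := by
  classical
  set P := (fun y z : Fin (K + 1) → S => t * ptGraphSwap μ (fun r : Fin m => (((0 : Fin (K + 1)), (κ r).succ) : Fin (K + 1) × Fin (K + 1))) (fun _ : Fin m => Equiv.refl S) y z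
            + (1 - t) * prodKernel w M y z) with hP
  have hthird := homStar_full_tvDist_ge_third κ hm hμ hμsum hhom hw0 hw00 hw1 ht0 ht1 hM0 hidle hunif hWdef hinj hsum hsurj hhub hK hacc hKoff hKdiag hA hB hSl hg hZ hπS hΛh
    hΛc u ha0 ha1 ha hn
  rw [← hP] at hthird
  have hrow := homStar_tensor_rowsum (K := K) (m := m) (w := w) (t := t) hμ hμsum hw0 hw1 hM0 hidle
    (fun r : Fin m => (((0 : Fin (K + 1)), (κ r).succ) : Fin (K + 1) × Fin (K + 1))) (fun _ : Fin m => Equiv.refl S)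
  have hDB := homStar_tensor_detailedBalance (K := K) (m := m) (w := w) (t := t) hμ hM0 hidle
    (fun r : Fin m => (((0 : Fin (K + 1)), (κ r).succ) : Fin (K + 1) × Fin (K + 1))) (fun _ : Fin m => Equiv.refl S)
  have hPrs : IsRowStochastic P := by
    refine ⟨fun y z => ?_, fun y => hrow y⟩
    rw [hP]; simp only
    have h1 := (ptGraphSwap_isRowStochastic (e := fun r : Fin m => (((0 : Fin (K + 1)), (κ r).succ) : Fin (K + 1) × Fin (K + 1))) (φ := fun _ => Equiv.refl S) hμ).1 y z
    have hMrs : ∀ k, IsRowStochastic (M k) := by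
      intro k
      refine Fin.cases ?_ (fun i => ?_) k
      · exact ⟨fun u v => by rw [hM0]; exact (hμ 0 v).le, fun u => by simp_rw [hM0]; exact hμsum 0⟩
      · refine ⟨fun u v => by rw [hidle]; split_ifs <;> norm_num, fun u => ?_⟩
        simp_rw [hidle]; rw [Finset.sum_ite_eq' univ u]; simp
    have h2 := (prodKernel_isRowStochastic (P := M) (w := w) hw0 hw1 hMrs).1 y z
    exact add_nonneg (mul_nonneg ht0.le h1) (mul_nonneg (by linarith) h2)
  have hst : IsStationary (tensorFun μ) P := hDB.isStationary hPrs.2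
  by_contra h
  push Not at h
  obtain ⟨t₀, ht₀⟩ := hmix
  have hd := worstTvDist_le_of_mixingTime_le hPrs hst ht₀ h
  have hw' := tvDist_single_le_worstTvDist P (tensorFun μ) n (fun _ : Fin (K + 1) => u)
  linarith

end FullLaw

end Summit.Ventures.LatticeQCDFlow.Scaling

end
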